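import Literature.AlgebraicGeometry.Motives.MotivatedCycles
import Literature.AlgebraicGeometry.Motives.MotivatedCyclesProofs
import HarnessLib

/-!
# Motivated cycles with André's product polarisations (corrected statement of Prop. 2.1 (i))

André, *Pour une théorie inconditionnelle des motifs*, Publ. Math. IHÉS 83 (1996), §2.1, Déf. 1,
defines a motivated cycle on a smooth projective `X` as a class `pr^{XY}_{X*} (α ∪ ⋆β)` where
`Y` is an auxiliary smooth projective variety ("pièce de base"), `α, β` are algebraic classes on
`X × Y`, and `⋆ = ⋆_{XY}` is the Lefschetz involution of `X × Y` **relative to the product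
polarisation** `η_{X×Y} = [X] ⊗ η_Y + η_X ⊗ [Y]`, `η_X` (resp. `η_Y`) being the class of an
arbitrary ample invertible sheaf on `X` (resp. `Y`). Prop. 2.1 (i) (p. 14, proof p. 15): the
motivated cycles form a sub-algebra of `H•(X)` for the cup product. The printed proof writes the
product of two generators as `pr^{XYXZ}_{X*} (pr*[Δ] ∪ (α ⊗ γ) ∪ (⋆β ⊗ ⋆δ))` and converts
`⋆β ⊗ ⋆δ` into a `ℚ`-combination of classes `a ∪ ⋆_{(XY)×(XZ)} b` (`a`, `b` algebraic) by
Lemme 1.3.2, where `⋆_{(XY)×(XZ)}` is the involution of the *product polarisation*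
`η_{XY} ⊗ 1 + 1 ⊗ η_{XZ}` of `(X × Y) × (X × Z) ≅ X × (Y × X × Z)`; so the auxiliary variety of
the product is `Y × X × Z`, polarised by the exterior sum `η_Y ⊞ η_X ⊞ η_Z`.

## Why this file exists (discrepancy with `MotivatedCycles.lean`)

The tree's `WeilCohomology.IsMotivatedClass` (`Motives/MotivatedCycles.lean`) polarises the
auxiliary product `X × Y` by an **arbitrary hyperplane class `η` of `X × Y`**
(`W.IsHyperplaneClass (X ⊗ Y) η`, i.e. the pull-back of an effective divisor class of `ℙᴺ` along
a closed immersion of `X × Y`) instead of André's product polarisation, and its module docstring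
justifies this by "André 1996 Prop. 2.3 shows `A_mot(X)` does not depend on the choice of
polarisations". This is not what the source says: Prop. 2.3 (p. 17) states that two *comparable
Weil cohomologies* give canonically isomorphic algebras of motivated cycles. The source's actual
polarisation-independence statement is the Remarque of §3.2 (p. 21, after Prop. 3.2.2): «On
aurait pu donner une définition plus restrictive des cycles motivés en fixant une polarisation
sur tout objet de `𝒱`, de manière compatible aux produits et sommes disjointes … cette
définition alternative conduit … aux mêmes espaces `A_mot(X)_E` (ne dépendant donc pas du choix
des polarisations `η_X`)», proved by showing that for any other polarisation `η'_X` the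
involution `⋆_{L'}` lies in `C_mot(X, X)` of the alternative version — `(⋆_L (L')^{i-d})^{-1}` is a
polynomial with coefficients in `Q` in `⋆_L (L')^{i-d} π^i` by Cayley–Hamilton and Prop. 3.2.2 —
that is, **after and by means of** the theory of §§2–3 for a product-compatible system of
polarisations (composition of motivated correspondences, Prop. 2.1 and its Corollaire; the
Künneth projectors and `⋆_L ∈ C_mot(X, X)`, Prop. 2.2; rationality of characteristic
polynomials, Prop. 3.2.2). It therefore presupposes Prop. 2.1 for product polarisations and
cannot be used to prove the tree's `motivatedClasses_cup_le` directly.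

What the Remarque does give, once that theory is available for the definitions of this file, is
one inclusion: a tree generator `pr_{X*} (α ∪ ⋆_η β)` with `η` an arbitrary hyperplane class of
`X × Y` lies in the span `prodMotivatedClasses` (apply the Remarque to `X × Y ∈ 𝒱` and `η`, then
Prop. 2.1 (ii)). The converse inclusion — and with it any transfer of Prop. 2.1 (i) back to the
tree's `motivatedClasses` — needs exterior sums of hyperplane classes to be hyperplane classes,
and in the axiomatics of `Literature.AlgebraicGeometry.Motives.WeilCohomology` the predicate
`IsHyperplaneClass` is **not** provably closed under exterior sums (this would need the
compatibility of the cycle map with pull-back of divisors along the Segre embedding, which is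
not an axiom; cf. the module docstring of `Motives/StandardConjectures.lean`). Concretely, the
printed proof of Prop. 2.1 (i) does not establish `WeilCohomology.motivatedClasses_cup_le`: the
generator it produces is polarised by the exterior sum `η_{XY} ⊞ η_{XZ}`, which is not known to
be a hyperplane class of `X × (Y × X × Z)`; and André's independence argument cannot replace it
by a genuine hyperplane class of that variety, because it runs inside a product-compatible
system (it passes through `⋆` of the product polarisation on `X × X`, Prop. 2.2, and through
composition, Prop. 2.1), which is exactly the unavailable ingredient. The same remark applies to
`WeilCohomology.motivatedClasses_map_pullback_le` (Prop. 2.1 (ii) of the paper).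

This file therefore vendors André's definition **as printed** — with the class of polarisations
generated by hyperplane classes under exterior sums standing in for "classe d'un quelconque
faisceau inversible ample" (the tree has no other ampleness notion for cohomology classes; this
class is exactly what §§1.3, 2.1–2.2 of the paper manipulate: products of polarised base
pieces; and by the Remarque of §3.2, p. 21, restricting Déf. 1 to any product-compatible system
of polarisations yields the same spaces `A_mot(X)_E`, so nothing of André's `A_mot(X)` is lost
by this restriction). The old declarations are left untouched. The **corrected statement of Prop. 2.1 (i)**
for these definitions is the following `Prop` (recorded here, not declared: under D-0026 a named
fact is vendored by a cite unit, not by the proving seat that found the discrepancy):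

```
def WeilCohomology.prodMotivatedClasses_cup_le : Prop :=
  W.HasHardLefschetz → ∀ {n : ℕ} {X : SchemeOver k}, IsSmoothProjective n X →
    ∀ {p q r : ℕ} (h : p + q = r),
    Submodule.map₂ (W.cup (show 2 * p + 2 * q = 2 * r by omega)) (W.prodMotivatedClasses n X p)
        (W.prodMotivatedClasses n X q) ≤ W.prodMotivatedClasses n X r
```

Its printed proof (p. 15): `pr^{XY}_{X*}(α ∪ ⋆β) ∪ pr^{XZ}_{X*}(γ ∪ ⋆δ)
= pr^{XYXZ}_{X*}(pr*[Δ] ∪ (α ⊗ γ) ∪ (⋆β ⊗ ⋆δ))`, then Lemme 1.3.2; if the two generators use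
different polarisations of `X`, one first passes to `X × X` with `[Δ]` (proof of (i), linearity
part). Ingredients a proof needs, none of which is in the tree yet: hard Lefschetz for product
polarisations (`𝔰𝔩₂` tensor products, by induction on `IsPolarisation`), André's Lemme 1.1,
1.3.1 (Clebsch–Gordan), 1.3.2, the push-forward / external-product calculus on `X × Y × X × Z`
with the diagonal class of `exists_isInducedBy_id`, and transport of `⋆` along the associator
`(X ⊗ Y) ⊗ (X ⊗ Z) ≅ X ⊗ (Y ⊗ (X ⊗ Z))`. For the comparison with the tree's `motivatedClasses`
(the inclusion `motivatedClasses ≤ prodMotivatedClasses`) a cite unit would in addition rely on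
the Remarque of §3.2, p. 21 (with Prop. 2.1 Corollaire, Prop. 2.2 and Prop. 3.2.2 for product
polarisations).

## Main definitions

* `PreWeilCohomology.prodPolarisation W X Y η_X η_Y = pr₁* η_X + pr₂* η_Y ∈ H²(X × Y)`.
* `PreWeilCohomology.IsPolarisation W n X η` : `X` is smooth projective of dimension `n` and
  `η` is a hyperplane class of `X`, or (inductively) `X = X₁ ⊗ X₂`, `n = n₁ + n₂` and `η` is the
  product polarisation of polarisations of the factors; polarisations are rational algebraic
  (`WeilCohomology.IsPolarisation.mem_ratAlgebraicClasses`).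
* `WeilCohomology.IsProdMotivatedClass W n X p x` : André's Déf. 1 verbatim (relational form of
  `pr_{X*}` by the projection formula, as in `IsMotivatedClass`).
* `WeilCohomology.prodMotivatedClasses W n X p` : their `K`-span `A_mot^p(X) ⊗ K ⊆ H²ᵖ(X)`.

## Design choices

* As in `MotivatedCycles.lean`: degrees are natural numbers with explicit equations; `pr_{X*}`
  is characterised by the projection formula against all `pr_X* y` (Poincaré duality makes it
  unique); `⋆` is any graded operator satisfying Kleiman's characterisation `W.IsLefschetzStar`
  for the product polarisation (unique under hard Lefschetz for that class, which follows from
  `W.HasHardLefschetz` on the factors by the `𝔰𝔩₂`-formalism, André 1996 §1.3 first paragraph;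
  not proved here); coefficients: `α, β ∈ A(X × Y)_ℚ = W.ratAlgebraicClasses`, span over `K`
  (André's `E`-linearity uses disjoint unions of base pieces, which `IsSmoothProjective`
  (geometrically irreducible) excludes, so the statement is about the span, exactly as for
  `motivatedClasses`).
* André's empty product `Spec K` (footnote p. 13) is not added as a separate polarised base
  piece: the statement of Prop. 2.1 (i) holds for every family of base pieces stable under
  products, and its proof never uses `Spec K`.
* Mathlib has no Weil-cohomology / Lefschetz / motivated-cycle vocabulary (searched
  `motivated`, `Lefschetz`, `polarisation`, `WeilCohomology`); everything is built on the tree's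
  `PreWeilCohomology` / `WeilCohomology` and Mathlib's `Submodule.span`, `Submodule.map₂`.

## References

* Y. André, *Pour une théorie inconditionnelle des motifs*, Publ. Math. IHÉS 83 (1996), 5–49:
  §1.3 (Lemme 1.3.1, 1.3.2), §2.1 (Déf. 1, Prop. 2.1 and its proof, Corollaire), §2.2
  (Prop. 2.2), Prop. 2.3 (p. 17), §3.2 (Prop. 3.2.1, 3.2.2 and the Remarque p. 21:
  independence of the choice of a product-compatible system of polarisations).
* S. Kleiman, *Algebraic cycles and the Weil conjectures* (1968), §1.4 (the operators `L`, `Λ`,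
  `⋆` and product polarisations).
-/

universe u v

open CategoryTheory AlgebraicGeometry MonoidalCategory CartesianMonoidalCategory
open scoped TensorProduct

noncomputable section

namespace Literature.AlgebraicGeometry.Motives

/-! ## Product polarisations -/

namespace PreWeilCohomology

variable {k : Type u} [Field k] {K : Type v} [Field K] (W : PreWeilCohomology k K)

/-- The **product polarisation** of `X × Y` attached to classes `η_X ∈ H²(X)`, `η_Y ∈ H²(Y)`:
`η_{X×Y} = [X] ⊗ η_Y + η_X ⊗ [Y] = pr₁* η_X + pr₂* η_Y ∈ H²(X × Y)` (André 1996 §1.3 and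
Déf. 1, the class of `pr₁* 𝓛_X ⊗ pr₂* 𝓛_Y`; Kleiman 1968 §1.4). [cite: Andre1996Motifs, §1.3 and §2.1 Déf. 1] -/
def prodPolarisation (X Y : SchemeOver k) (ηX : W.obj X 2) (ηY : W.obj Y 2) : W.obj (X ⊗ Y) 2 :=
  W.pullback (fst X Y) 2 ηX + W.pullback (snd X Y) 2 ηY

/-- Unfolding of `prodPolarisation`. [folklore] -/
lemma prodPolarisation_def (X Y : SchemeOver k) (ηX : W.obj X 2) (ηY : W.obj Y 2) :
    W.prodPolarisation X Y ηX ηY = W.pullback (fst X Y) 2 ηX + W.pullback (snd X Y) 2 ηY := rfl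

/-- The product polarisation is symmetric under the swap `σ : Y × X ≅ X × Y`:
`σ* (pr₁* η_X + pr₂* η_Y) = pr₁* η_Y + pr₂* η_X` (functoriality of pull-back only). [folklore] -/
lemma transposeClass_prodPolarisation (X Y : SchemeOver k) (ηX : W.obj X 2) (ηY : W.obj Y 2) :
    W.transposeClass (W.prodPolarisation X Y ηX ηY) = W.prodPolarisation Y X ηY ηX := by
  simp only [transposeClass, prodPolarisation, map_add]
  rw [← LinearMap.comp_apply (W.pullback (β_ Y X).hom 2), ← W.pullback_comp, braiding_hom_fst,
    ← LinearMap.comp_apply (W.pullback (β_ Y X).hom 2), ← W.pullback_comp, braiding_hom_snd,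
    add_comm]

/-- The **polarised smooth projective varieties** of André 1996 §2.1: `W.IsPolarisation n X η`
says that `X` is smooth projective of dimension `n` and `η ∈ H²(X)` is an admissible
polarisation, i.e. (inductively) either a hyperplane class of `X` (`W.IsHyperplaneClass`, the
class of a hyperplane section for a projective embedding), or the product polarisation
`pr₁* η₁ + pr₂* η₂` of two polarised varieties `(X₁, η₁)`, `(X₂, η₂)` with `X = X₁ ⊗ X₂`,
`n = n₁ + n₂` (André: "`η_X` désignant la classe d'un quelconque faisceau inversible ample sur
`X`", the auxiliary products being polarised by `[X] ⊗ η_Y + η_X ⊗ [Y]`, Déf. 1 and §1.3; base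
pieces are stable under products, §2.1). This inductive closure stands in for ampleness, which
the tree does not have for cohomology classes; it is a product-compatible system of
polarisations, and by the Remarque of §3.2 (p. 21) Déf. 1 restricted to any such system gives
the same spaces `A_mot(X)_E` as arbitrary ample polarisations. `IsHyperplaneClass` itself is
not provably closed under exterior sums in the axiomatics of `WeilCohomology` (no compatibility
of the cycle map with pull-back of divisors along the Segre embedding). The dimension and the
smooth-projectivity of the factors are recorded because they are not recoverable from the
product. [cite: Andre1996Motifs, §2.1 Déf. 1 and §3.2 Remarque p. 21] -/
inductive IsPolarisation : (n : ℕ) → (X : SchemeOver k) → W.obj X 2 → Prop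
  /-- A hyperplane class of a smooth projective variety is a polarisation. -/
  | ofIsHyperplaneClass {n : ℕ} {X : SchemeOver k} {η : W.obj X 2} :
      IsSmoothProjective n X → W.IsHyperplaneClass X η → IsPolarisation n X η
  /-- The product polarisation of two polarised varieties polarises the product. -/
  | prod {n m : ℕ} {X Y : SchemeOver k} {ηX : W.obj X 2} {ηY : W.obj Y 2} :
      IsPolarisation n X ηX → IsPolarisation m Y ηY →
        IsPolarisation (n + m) (X ⊗ Y) (W.prodPolarisation X Y ηX ηY)

variable {W} in
/-- Hyperplane classes of smooth projective varieties are polarisations (the base case). [folklore] -/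
lemma IsHyperplaneClass.isPolarisation {n : ℕ} {X : SchemeOver k} {η : W.obj X 2}
    (hX : IsSmoothProjective n X) (hη : W.IsHyperplaneClass X η) : W.IsPolarisation n X η :=
  IsPolarisation.ofIsHyperplaneClass hX hη

variable {W} in
/-- Product polarisations of polarisations are polarisations (the inductive step). [folklore] -/
lemma IsPolarisation.prodPolarisation {n m : ℕ} {X Y : SchemeOver k} {ηX : W.obj X 2}
    {ηY : W.obj Y 2} (hX : W.IsPolarisation n X ηX) (hY : W.IsPolarisation m Y ηY) :
    W.IsPolarisation (n + m) (X ⊗ Y) (W.prodPolarisation X Y ηX ηY) :=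
  IsPolarisation.prod hX hY

variable {W} in
/-- A polarised variety is smooth projective of the recorded dimension (products of smooth
projective varieties are smooth projective: the discharged fact `IsSmoothProjective.tensor`,
Segre embedding). [folklore] -/
lemma IsPolarisation.isSmoothProjective {n : ℕ} {X : SchemeOver k} {η : W.obj X 2}
    (h : W.IsPolarisation n X η) : IsSmoothProjective n X := by
  induction h with
  | ofIsHyperplaneClass hX _ => exact hX
  | prod _ _ ihX ihY => exact IsSmoothProjective.tensor_holds ihX ihY

end PreWeilCohomology

namespace WeilCohomology

variable {k : Type u} [Field k] {K : Type v} [Field K] [CharZero K] (W : WeilCohomology k K)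

variable {W} in
/-- **Polarisations are algebraic**: a polarisation `η` of `X` lies in `A¹(X)_ℚ` (a hyperplane
class is the pull-back of a divisor class of `ℙᴺ`, `mem_ratAlgebraicClasses_of_isHyperplaneClass`;
pull-backs and sums of rational algebraic classes are rational algebraic, C-lite axiom
`pullback_ratAlgebraicClasses_le`). In particular the Lefschetz operator `L = (· ∪ η)` of a
polarisation is an algebraic correspondence (Kleiman 1968 §1.4). [folklore] -/
theorem IsPolarisation.mem_ratAlgebraicClasses {n : ℕ} {X : SchemeOver k} {η : W.obj X 2}
    (h : W.IsPolarisation n X η) : η ∈ W.ratAlgebraicClasses X 1 := by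
  induction h with
  | ofIsHyperplaneClass hX hη => exact W.mem_ratAlgebraicClasses_of_isHyperplaneClass hX hη
  | @prod n m X Y ηX ηY hX hY ihX ihY =>
    have hXY : IsSmoothProjective (n + m) (X ⊗ Y) :=
      IsSmoothProjective.tensor_holds hX.isSmoothProjective hY.isSmoothProjective
    exact add_mem (W.pullback_mem_ratAlgebraicClasses hXY hX.isSmoothProjective (fst X Y) ihX)
      (W.pullback_mem_ratAlgebraicClasses hXY hY.isSmoothProjective (snd X Y) ihY)

/-! ## Motivated classes in the sense of André's Déf. 1 -/

/-- A class `x ∈ H²ᵖ(X)` (`X` smooth projective of dimension `n`) *is a motivated class in the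
sense of André 1996, Déf. 1* (product-polarised form): there are a polarisation `η_X` of `X`
and a polarised smooth projective `(Y, η_Y)` of dimension `m` (`W.IsPolarisation`, which records
`IsSmoothProjective m Y`), a Lefschetz involution `⋆ = S` of `X × Y` **for the product
polarisation `pr₁* η_X + pr₂* η_Y`** (`W.IsLefschetzStar (n + m) (W.prodPolarisation X Y η_X η_Y) S`),
and rational algebraic classes `α ∈ Aᵃ(X × Y)_ℚ`, `β ∈ Aᵇ(X × Y)_ℚ` (`⋆β ∈ H^{2b'}`,
`b + b' = n + m`, `a + b' = p + m`) with `x = pr_{X*} (α ∪ ⋆β)`, the push-forward being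
expressed by the projection formula: for every `y ∈ H^{2q}(X)`, `p + q = n`,
`tr_X (x ∪ y) = tr_{X×Y} ((α ∪ ⋆β) ∪ pr_X* y)`.
Compare `IsMotivatedClass`, which instead allows any hyperplane class of `X × Y` as the
polarisation (see the module docstring for why the two are not interchangeable in this
axiomatics). [cite: Andre1996Motifs, §2.1 Déf. 1] -/
def IsProdMotivatedClass (n : ℕ) (X : SchemeOver k) (p : ℕ) (x : W.obj X (2 * p)) : Prop :=
  ∃ (m : ℕ) (Y : SchemeOver k) (ηX : W.obj X 2) (_ : W.IsPolarisation n X ηX) (ηY : W.obj Y 2)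
    (_ : W.IsPolarisation m Y ηY) (S : W.GradedOp (X ⊗ Y) (X ⊗ Y))
    (_ : W.IsLefschetzStar (n + m) (W.prodPolarisation X Y ηX ηY) S) (a b b' : ℕ)
    (_ : b + b' = n + m) (hab : a + b' = p + m) (α : W.obj (X ⊗ Y) (2 * a))
    (β : W.obj (X ⊗ Y) (2 * b)),
    α ∈ W.ratAlgebraicClasses (X ⊗ Y) a ∧ β ∈ W.ratAlgebraicClasses (X ⊗ Y) b ∧
      ∀ (q : ℕ) (hq : p + q = n) (y : W.obj X (2 * q)),
        W.cupPairing X n (2 * p) (2 * q) (by omega) x y =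
          W.trace (X ⊗ Y) (n + m)
            (W.cup (show 2 * (p + m) + 2 * q = 2 * (n + m) by omega)
              (W.cup (show 2 * a + 2 * b' = 2 * (p + m) by omega) α (S (2 * b) (2 * b') β))
              (W.pullback (fst X Y) (2 * q) y))

/-- The `K`-subspace `A_mot^p(X) ⊗ K ⊆ H²ᵖ(X)` spanned by the motivated classes of André's
Déf. 1 (product-polarised form, `W.IsProdMotivatedClass`); André 1996 §2.1. [cite: Andre1996Motifs, §2.1 Déf. 1] -/
def prodMotivatedClasses (n : ℕ) (X : SchemeOver k) (p : ℕ) : Submodule K (W.obj X (2 * p)) :=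
  Submodule.span K {x | W.IsProdMotivatedClass n X p x}

variable {W}
variable {n : ℕ} {X : SchemeOver k}

/-- A motivated class (Déf. 1) lies in `prodMotivatedClasses`. [folklore] -/
lemma IsProdMotivatedClass.mem_prodMotivatedClasses {p : ℕ} {x : W.obj X (2 * p)}
    (hx : W.IsProdMotivatedClass n X p x) : x ∈ W.prodMotivatedClasses n X p :=
  Submodule.subset_span hx

/-- `prodMotivatedClasses` is the smallest subspace containing the motivated classes. [folklore] -/
lemma prodMotivatedClasses_le_iff {p : ℕ} {V : Submodule K (W.obj X (2 * p))} :
    W.prodMotivatedClasses n X p ≤ V ↔ ∀ x, W.IsProdMotivatedClass n X p x → x ∈ V :=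
  Submodule.span_le

/-- The data of a motivated class force `X` to be smooth projective of dimension `n` (recorded
in the polarisation `η_X`). [folklore] -/
lemma IsProdMotivatedClass.isSmoothProjective {p : ℕ} {x : W.obj X (2 * p)}
    (hx : W.IsProdMotivatedClass n X p x) : IsSmoothProjective n X := by
  obtain ⟨_, _, _, hηX, -⟩ := hx
  exact hηX.isSmoothProjective

end WeilCohomology

end Literature.AlgebraicGeometry.Motives

end
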